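import Literature.Probability.RandomPlanarGeometry.SLERSObservableIto
import Literature.Probability.Process.MartingaleLimit
import HarnessLib

/-!
# The Itô step of Rohde–Schramm's Lemma 6.3 proved; Lemma 6.3 for `κ ≥ 8` unconditionally

Topic `Probability/RandomPlanarGeometry`; theorems only. Discharge of the named fact
`Literature.Probability.RandomPlanarGeometry.sle_martingale_rsObservable` of
`SLEDerivRatioMartingale` (Rohde–Schramm (2005), proof of Lemma 6.3, pp. 904–905: "`Mₜ` is a
local martingale … Set `t̄ₙ := T ∧ tₙ`. The optional sampling theorem then gives
`Ĝ(ẑ) = M₀ = E[M_{t̄ₙ}]`", "`M₀ = E[M_{T_m ∧ tₙ}] → E[M_{T_m}]`"):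

* `Literature.Probability.RandomPlanarGeometry.sle_martingale_rsObservable_holds`: for `κ > 0`,
  `a < 0` with `32aκ + (2κ-8)² ≥ 0`, `z ∈ ℍ` and a level `s`, the observable
  `Mₜ = ψₜ^a Ĝ_{a,κ}(zₜ)` stopped at the exit time `T` of `|w|` from `[0, s)` is a martingale of the
  raw Brownian filtration under the pre-Wiener measure. Proof: for `|w₀| < s`, the observables
  stopped at the stopping times `T ∧ ρₙ` (`sleCotArgLocTime`, `SLEPointFlowStopped`) are martingales
  by the Itô computation `martingale_stoppedProcess_sleRSObservable_of_le_locTime`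
  (`SLERSObservableIto`), bounded by `sup_{|v| ≤ s} |Ĝ(v + i)|` (`0 < ψ^a ≤ 1`), and converge at
  every `ω` to `M_{t∧T}` (if `t ∧ T < τ(z)` the clocks `t ∧ T ∧ ρₙ` are eventually `t ∧ T`,
  `exists_le_slePointLocTime`; otherwise `T = ∞`, `t ≥ τ(z)`, and `M_{ρₙ} → 0 = M_t` because
  `ψ_{ρₙ} → ∞` along `ρₙ ↑ τ(z)`, `Loewner.tendsto_derivRatio_atTop_of_abs_cotArg_le`), so the limit
  is a martingale (`Literature.Probability.Process.martingale_of_tendsto_of_abs_le'`) — this is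
  the printed passage to the limit `n → ∞`; for `|w₀| ≥ s` the exit time is `0` and the stopped
  observable is the constant `Ĝ(z)`;
* consequently **Lemma 6.3 for `κ ≥ 8` holds unconditionally**
  (`tendsto_sleDerivRatio_atTop_of_eight_le_holds`,
  `tendsto_integral_derivRatioRate_atTop_of_eight_le_holds`), and the space-filling phase
  `ae_isSpaceFilling_sleTrace_of_eight_le` is reduced to the three trace theorems of other files
  (SLE₈ has a trace, LSW04 Thm 4.7; the trace exists for `κ ≠ 8`, RS05 Thm 5.1; transience,
  RS05 Thm 7.1): `ae_isSpaceFilling_sleTrace_of_eight_le_of_traceFacts`.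

## References

* S. Rohde, O. Schramm, *Basic properties of SLE*, Ann. of Math. 161 (2005), Lemma 6.3 and its
  proof (pp. 903–906), Cor. 7.4 and Update (p. 911).
* D. Revuz, M. Yor, *Continuous Martingales and Brownian Motion* (1999), Ch. II §1, Ch. IV §3.
-/

noncomputable section

open Set Filter MeasureTheory Complex
open _root_.Topology
open scoped NNReal ENNReal

namespace Literature.Probability.RandomPlanarGeometry

open Loewner Literature.Probability.Process Literature.Analysis.FunctionSpaces

variable {κ : ℝ≥0} {z : ℂ} {n : ℕ} {σ : (ℝ≥0 → ℝ) → WithTop ℝ≥0}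

/-! ### The stopped observables `M_{t ∧ T ∧ ρₙ}`: bound and limit -/

/-- **Uniform bound**: for `a ≤ 0` and a random time `σ ≤ ρₙ` along which `|w| ≤ S`, the stopped
observable satisfies `|M_{t∧σ}| ≤ sup_{|v|≤S} |Ĝ_{a,κ}(v + i)|` (`0 < ψ^a ≤ 1`; "`Ĝ(z_{t∧T})` is
bounded", p. 905). [cite: RohdeSchramm2005, Lemma 6.3 (proof)] -/
theorem abs_stoppedProcess_sleRSObservable_le (hz : 0 < z.im)
    (hσρ : ∀ ω, σ ω ≤ slePointLocTime κ z n ω) {a : ℝ} (ha : a ≤ 0) {S C : ℝ}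
    (hS : ∀ (ω : ℝ≥0 → ℝ) (t : ℝ≥0), (t : WithTop ℝ≥0) ≤ σ ω → |cotArg (sleDriving κ ω) z t| ≤ S)
    (hC : ∀ v ∈ Icc (-S) S, |rsGhatSlope a κ v| ≤ C) (t : ℝ≥0) (ω : ℝ≥0 → ℝ) :
    |stoppedProcess (sleRSObservable κ a z) σ t ω| ≤ C := by
  have hT := coe_untopA_min_lt_swallowingTime hz hσρ t ω
  have him : (centredMap (sleDriving κ ω) ((min (t : WithTop ℝ≥0) (σ ω)).untopA) z).im ≠ 0 :=
    (im_centredMap_pos (continuous_sleDriving κ ω) hz hT).ne'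
  have hψ := stoppedProcess_slePointPsi_rpow_mem_Ioc hz hσρ ha t ω
  rw [stoppedProcess_slePointPsi_eq] at hψ
  have hw : |cotArg (sleDriving κ ω) z ((min (t : WithTop ℝ≥0) (σ ω)).untopA)| ≤ S :=
    hS ω _ (coe_untopA_min_le t (σ ω))
  have hC0 : 0 ≤ C := (abs_nonneg _).trans (hC _ (abs_le.1 hw))
  rw [stoppedProcess, sleRSObservable, rsObservable_of_lt hT, rsGhat_eq_rsGhatSlope a κ him,
    ← cotArg_apply, abs_mul, abs_of_pos hψ.1]
  calc _ ≤ 1 * C := mul_le_mul hψ.2 (hC _ (abs_le.1 hw)) (abs_nonneg _) zero_le_one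
    _ = C := one_mul C

/-- **Pointwise limit `n → ∞`** ("`M_{T_m ∧ tₙ} → M_{T_m}`", p. 905): for `a < 0` and every path,
`M_{t ∧ T ∧ ρₙ} → M_{t ∧ T}`. If `t ∧ T < τ(z)` the clocks agree for `n` large
(`exists_le_slePointLocTime`); otherwise `T = ∞` and `t ≥ τ(z)`, so `M_{t∧T} = Mₜ = 0` (the
cut-off value) while `M_{t∧T∧ρₙ} = M_{ρₙ} = ψ_{ρₙ}^a Ĝ(z_{ρₙ}) → 0`, because `ψ → ∞` along
`ρₙ ↑ τ(z)` when `|w|` stays below `s` (`Loewner.tendsto_derivRatio_atTop_of_abs_cotArg_le`) and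
`Ĝ(z_{ρₙ})` stays bounded. [cite: RohdeSchramm2005, Lemma 6.3 (proof)] -/
theorem tendsto_stoppedProcess_sleRSObservable_locTime (hz : 0 < z.im) {a : ℝ} (ha : a < 0)
    (s : ℝ) (t : ℝ≥0) (ω : ℝ≥0 → ℝ) :
    Tendsto (fun n : ℕ ↦ stoppedProcess (sleRSObservable κ a z) (sleCotArgLocTime κ z s n) t ω) atTop
      (𝓝 (stoppedProcess (sleRSObservable κ a z) (sleCotArgExitTime κ z s) t ω)) := by
  have hW := continuous_sleDriving κ ω
  by_cases hlt : min (t : WithTop ℝ≥0) (sleCotArgExitTime κ z s ω) < swallowingTime (sleDriving κ ω) z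
  · -- the clocks `t ∧ T ∧ ρₙ` are eventually `t ∧ T`
    have hu := coe_untopA_min t (sleCotArgExitTime κ z s ω)
    obtain ⟨N, hN⟩ := exists_le_slePointLocTime (κ := κ) hz ω
      (t := (min (t : WithTop ℝ≥0) (sleCotArgExitTime κ z s ω)).untopA) (by rwa [hu])
    refine tendsto_const_nhds.congr' ?_
    filter_upwards [eventually_ge_atTop N] with n hn
    have hle : min (t : WithTop ℝ≥0) (sleCotArgExitTime κ z s ω) ≤ slePointLocTime κ z n ω := by
      rw [← hu]; exact hN n hn
    simp only [stoppedProcess, sleCotArgLocTime]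
    rw [← min_assoc, min_eq_left hle]
  · -- `T = ∞`, `t ≥ τ(z)`: `M_{ρₙ} → 0 = Mₜ`
    push Not at hlt
    have hτt : swallowingTime (sleDriving κ ω) z ≤ (t : WithTop ℝ≥0) := hlt.trans (min_le_left _ _)
    have hτT : swallowingTime (sleDriving κ ω) z ≤ sleCotArgExitTime κ z s ω :=
      hlt.trans (min_le_right _ _)
    have hTtop : sleCotArgExitTime κ z s ω = ⊤ := by
      by_contra hne
      obtain ⟨t₀, ht₀⟩ := WithTop.ne_top_iff_exists.1 hne
      have h1 := (lt_swallowingTime_of_cotArgExitTime_eq_coe hW hz ht₀.symm).1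
      exact absurd (hτT.trans_eq ht₀.symm) (not_le.2 h1)
    have hTtop' : cotArgExitTime (sleDriving κ ω) z s = ⊤ := hTtop
    have hlim0 : stoppedProcess (sleRSObservable κ a z) (sleCotArgExitTime κ z s) t ω = 0 := by
      rw [stoppedProcess_eq_of_le (by rw [hTtop]; exact le_top), sleRSObservable,
        rsObservable_of_le hτt]
    rw [hlim0]
    -- the localizing times as finite times `ρₙ' < τ`
    obtain ⟨ρ', hρ'⟩ : ∃ ρ' : ℕ → ℝ≥0, ∀ n, ((ρ' n : ℝ≥0) : WithTop ℝ≥0) = slePointLocTime κ z n ω :=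
      ⟨fun n ↦ (slePointLocTime κ z n ω).untop (slePointLocTime_ne_top n ω), fun n ↦
        WithTop.coe_untop _ _⟩
    have hρ'τ : ∀ n, ((ρ' n : ℝ≥0) : WithTop ℝ≥0) < swallowingTime (sleDriving κ ω) z := fun n ↦ by
      rw [hρ']; exact slePointLocTime_lt_swallowingTime hz n ω
    have hval : ∀ n, stoppedProcess (sleRSObservable κ a z) (sleCotArgLocTime κ z s n) t ω =
        derivRatio (sleDriving κ ω) z (ρ' n) ^ a *
          rsGhat a κ (centredMap (sleDriving κ ω) (ρ' n) z) := by
      intro n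
      have hloc : sleCotArgLocTime κ z s n ω = ρ' n := by
        rw [sleCotArgLocTime, hTtop, min_eq_right le_top, ← hρ']
      rw [stoppedProcess_eq_of_ge (by rw [hloc]; exact (hρ'τ n).le.trans hτt), hloc]
      change sleRSObservable κ a z (ρ' n) ω = _
      rw [sleRSObservable, rsObservable_of_lt (hρ'τ n)]
    -- `|w| < s` before `τ`, hence `ψ → ∞` along `ρₙ'`
    have hs : ∀ r : ℝ≥0, (r : WithTop ℝ≥0) < swallowingTime (sleDriving κ ω) z →
        |cotArg (sleDriving κ ω) z r| ≤ s := fun r hr ↦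
      (abs_cotArg_lt_of_cotArgExitTime_eq_top (sleDriving κ ω) z hTtop' hr).le
    haveI : Nonempty {r : ℝ≥0 // (r : WithTop ℝ≥0) < swallowingTime (sleDriving κ ω) z} :=
      ⟨⟨ρ' 0, hρ'τ 0⟩⟩
    have hψ := tendsto_derivRatio_atTop_of_abs_cotArg_le hW hz hs
    have hψn : Tendsto (fun n ↦ derivRatio (sleDriving κ ω) z (ρ' n)) atTop atTop := by
      refine tendsto_atTop_atTop.2 fun b ↦ ?_
      obtain ⟨i, hi⟩ := tendsto_atTop_atTop.1 hψ b
      obtain ⟨N, hN⟩ := exists_le_slePointLocTime (κ := κ) hz ω i.2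
      refine ⟨N, fun n hn ↦ ?_⟩
      have hin : i.1 ≤ ρ' n := by
        have := hN n hn
        rw [← hρ'] at this
        exact WithTop.coe_le_coe.1 this
      exact hi ⟨ρ' n, hρ'τ n⟩ hin
    have hpow : Tendsto (fun n ↦ derivRatio (sleDriving κ ω) z (ρ' n) ^ a) atTop (𝓝 0) := by
      have h := (tendsto_rpow_neg_atTop (neg_pos.2 ha)).comp hψn
      simpa only [neg_neg, Function.comp_def] using h
    -- `Ĝ(z_{ρₙ'})` is bounded
    obtain ⟨C, hC⟩ : ∃ C, ∀ v ∈ Icc (-s) s, |rsGhatSlope a κ v| ≤ C := by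
      obtain ⟨C, hC⟩ := isCompact_Icc.exists_bound_of_continuousOn
        (contDiff_rsGhatSlope a κ (n := 0)).continuous.continuousOn
      exact ⟨C, fun v hv ↦ by simpa [Real.norm_eq_abs] using hC v hv⟩
    have hbd : ∀ n, ‖stoppedProcess (sleRSObservable κ a z) (sleCotArgLocTime κ z s n) t ω‖ ≤
        |derivRatio (sleDriving κ ω) z (ρ' n) ^ a| * C := by
      intro n
      rw [hval, Real.norm_eq_abs, abs_mul]
      have him : (centredMap (sleDriving κ ω) (ρ' n) z).im ≠ 0 :=
        (im_centredMap_pos hW hz (hρ'τ n)).ne'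
      rw [rsGhat_eq_rsGhatSlope a κ him, ← cotArg_apply]
      exact mul_le_mul_of_nonneg_left (hC _ (abs_le.1 (hs _ (hρ'τ n)))) (abs_nonneg _)
    refine squeeze_zero_norm hbd ?_
    simpa using ((continuous_abs.tendsto 0).comp hpow).mul_const C

/-! ### The Itô step of Lemma 6.3, proved -/

/-- **The Itô step of Rohde–Schramm's Lemma 6.3 holds**
(`Literature.Probability.RandomPlanarGeometry.sle_martingale_rsObservable`): for `κ > 0`, `a < 0`
with `32aκ + (2κ-8)² ≥ 0`, `z ∈ ℍ` and any level `s`, the observable `ψₜ^a Ĝ_{a,κ}(zₜ)` stopped at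
the exit time of `|w|` from `[0, s)` is a martingale of the raw Brownian filtration under the
pre-Wiener measure. For `|w₀| < s`: bounded pointwise limit (`martingale_of_tendsto_of_abs_le'`) of
the martingales `M_{t∧T∧ρₙ}` (`martingale_stoppedProcess_sleRSObservable_of_le_locTime`, Itô's
formula with vanishing drift (6.9)); for `|w₀| ≥ s` the exit time is `0` and the process is the
constant `Ĝ(z)`. [cite: RohdeSchramm2005, Lemma 6.3 (proof)] -/
theorem sle_martingale_rsObservable_holds : sle_martingale_rsObservable := by
  intro κ hκ a ha hdisc z hz s
  haveI := isProbabilityMeasure_preWienerMeasure'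
  by_cases h0 : |z.re / z.im| < s
  · obtain ⟨C, hC⟩ : ∃ C, ∀ v ∈ Icc (-s) s, |rsGhatSlope a κ v| ≤ C := by
      obtain ⟨C, hC⟩ := isCompact_Icc.exists_bound_of_continuousOn
        (contDiff_rsGhatSlope a κ (n := 0)).continuous.continuousOn
      exact ⟨C, fun v hv ↦ by simpa [Real.norm_eq_abs] using hC v hv⟩
    refine martingale_of_tendsto_of_abs_le'
      (M := fun n ↦ stoppedProcess (sleRSObservable κ a z) (sleCotArgLocTime κ z s n))
      (C := fun _ ↦ C) (fun n ↦ ?_) (fun n t ω ↦ ?_) (fun t ω ↦ ?_)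
    · exact martingale_stoppedProcess_sleRSObservable_of_le_locTime hκ hdisc hz
        (isStoppingTime_sleCotArgLocTime hz s n) (sleCotArgLocTime_le_locTime s n)
        fun ω t ht ↦ abs_cotArg_le_of_le_sleCotArgLocTime hz h0 ht
    · exact abs_stoppedProcess_sleRSObservable_le hz (sleCotArgLocTime_le_locTime s n) ha.le
        (fun ω t ht ↦ abs_cotArg_le_of_le_sleCotArgLocTime hz h0 ht) hC t ω
    · exact tendsto_stoppedProcess_sleRSObservable_locTime hz ha s t ω
  · -- `|w₀| ≥ s`: the exit time is `0`, the stopped observable is the constant `Ĝ(z)`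
    push Not at h0
    have hT : ∀ ω, sleCotArgExitTime κ z s ω = 0 := fun ω ↦ by
      have hW := continuous_sleDriving κ ω
      refine cotArgExitTime_eq_zero (sleDriving κ ω) z
        (swallowingTime_pos_holds hW (ne_driving_of_im_pos hz 0)) ?_
      rwa [cotArg_sleDriving_zero κ ω hz]
    have heq : stoppedProcess (sleRSObservable κ a z) (sleCotArgExitTime κ z s) =
        fun _ _ ↦ rsGhat a κ z := by
      funext t ω
      have hW := continuous_sleDriving κ ω
      rw [stoppedProcess_eq_of_ge (by rw [hT ω]; exact bot_le), hT ω]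
      change sleRSObservable κ a z 0 ω = rsGhat a κ z
      rw [sleRSObservable, rsObservable_zero hW hz, sleDriving_zero, Complex.ofReal_zero, sub_zero]
    rw [heq]
    exact martingale_const _ _ _

/-! ### Lemma 6.3 (`κ ≥ 8`) and the space-filling phase -/

/-- **Rohde–Schramm (2005), Lemma 6.3, case `κ ≥ 8`, PROVED**: for `κ ≥ 8` and `z ∈ ℍ`, almost
surely `ψₜ = (Im z) |gₜ'(z)| / Im gₜ(z) → ∞` as `t ↑ τ(z)` (so `P[Z(z) = ∞] = 1`, "which implies
`G = 0` when `κ > 8` and `a < 0`"; "`Ĝ_{·,8}(1) = ∞` … so that the above argument applies" for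
`κ = 8`, pp. 905–906). Assembled from the Itô step (`sle_martingale_rsObservable_holds`) by
`tendsto_sleDerivRatio_atTop_of_eight_le_of_martingale`. [cite: RohdeSchramm2005, Lemma 6.3] -/
theorem tendsto_sleDerivRatio_atTop_of_eight_le_holds : tendsto_sleDerivRatio_atTop_of_eight_le :=
  tendsto_sleDerivRatio_atTop_of_eight_le_of_martingale sle_martingale_rsObservable_holds

/-- Lemma 6.3 (`κ ≥ 8`) in the integral form (6.3), proved: almost surely
`∫₀ᵗ 4 yₛ² |zₛ|⁻⁴ ds → ∞` as `t ↑ τ(z)`. [cite: RohdeSchramm2005, Lemma 6.3 and eq. (6.3)] -/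
theorem tendsto_integral_derivRatioRate_atTop_of_eight_le_holds :
    tendsto_integral_derivRatioRate_atTop_of_eight_le :=
  tendsto_integral_derivRatioRate_atTop_of_eight_le_of_martingale sle_martingale_rsObservable_holds

/-- **crit-perc.S20, space-filling phase `κ ≥ 8`, from the three trace theorems**
(Rohde–Schramm (2005), Cor. 7.4 and Update, p. 911): `ae_isSpaceFilling_sleTrace_of_eight_le`
follows from SLE₈ being generated by a curve (`hasSLETrace_eight`, Lawler–Schramm–Werner (2004),
Thm 4.7), the existence of the trace for `κ ≠ 8` (`hasSLETrace_of_ne_eight`, RS05 Thm 5.1) and the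
transience of the trace (`tendsto_norm_sleTrace_atTop`, RS05 Thm 7.1 + Update); the Itô step of
Lemma 6.3 being now proved, these are the only remaining inputs.
[cite: RohdeSchramm2005, Cor. 7.4 and Update (p. 911)] -/
theorem ae_isSpaceFilling_sleTrace_of_eight_le_of_traceFacts (h8 : hasSLETrace_eight)
    (hne : hasSLETrace_of_ne_eight) (htr : tendsto_norm_sleTrace_atTop) {κ : ℝ≥0} :
    ae_isSpaceFilling_sleTrace_of_eight_le (κ := κ) :=
  ae_isSpaceFilling_sleTrace_of_eight_le_of_itoFacts h8 hne htr sle_martingale_rsObservable_holds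

/-! ### Per-`κ` assembly: density and space-filling from `HasSLETrace κ` and transience at `κ` -/

section PerKappa

open Metric UpperHalfPlane

/-- **Per-point density of the SLE_κ trace for one `κ ≥ 8`** (Rohde–Schramm (2005), "from
Lemma 6.3 and (6.2) we know that `γ[0, ∞)` is a.s. dense", p. 911), now needing only that SLE_κ
*for this `κ`* is generated by a curve (`HasSLETrace κ`): for `z ∈ ℍ`, almost surely
`dist(z, γ[0, ∞) ∪ ℝ) = 0`. Same argument as `ae_infDist_sleTrace_eq_zero_of_eight_le_of_facts`
(`dist(z, γ[0,∞) ∪ ℝ) ≤ dist(z, Hₜᶜ) ≤ 2 Im gₜ(z)/|gₜ'(z)| = 2 Im z/ψₜ`, eq. (6.2)), with Lemma 6.3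
supplied by the proved `tendsto_sleDerivRatio_atTop_of_eight_le_holds`.
[cite: RohdeSchramm2005, Lemma 6.3 and eq. (6.2)] -/
theorem ae_infDist_sleTrace_eq_zero_of_hasSLETrace {κ : ℝ≥0} (hγ : HasSLETrace κ) (hκ : 8 ≤ κ)
    {z : ℂ} (hz : z ∈ upperHalfPlaneSet) :
    ∀ᵐ ω ∂Process.preWienerMeasure, infDist z (range (sleTrace κ ω) ∪ {w : ℂ | w.im = 0}) = 0 := by
  filter_upwards [ae_isGeneratedByCurve_sleTrace hγ,
    tendsto_sleDerivRatio_atTop_of_eight_le_holds hκ z hz] with ω hg hT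
  have hW : Continuous (sleDriving κ ω) := continuous_sleDriving κ ω
  set S : Set ℂ := range (sleTrace κ ω) ∪ {w : ℂ | w.im = 0} with hS_def
  have hzim : 0 < z.im := hz
  have hzW : z ≠ sleDriving κ ω 0 := ne_driving_of_im_pos hzim 0
  have h0 : ((0 : ℝ≥0) : WithTop ℝ≥0) < swallowingTime (sleDriving κ ω) z :=
    swallowingTime_pos_holds hW hzW
  haveI : Nonempty {t : ℝ≥0 // (t : WithTop ℝ≥0) < swallowingTime (sleDriving κ ω) z} := ⟨⟨0, h0⟩⟩
  refine le_antisymm (le_of_forall_pos_lt_add fun ε hε ↦ ?_) infDist_nonneg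
  -- pick `t < τ(z)` with `ψₜ ≥ M := 2 Im z / ε + 1`
  obtain ⟨t, ht⟩ := (hT.eventually_ge_atTop (2 * z.im / ε + 1)).exists
  have hzdom : z ∈ domain (sleDriving κ ω) t := (mem_domain_iff _ _ _).2 ⟨hz, t.2⟩
  have him : 0 < (sleMap κ ω t z).im := mapsTo_map hW t hzdom
  have h1 : infDist z S ≤ infDist z (domain (sleDriving κ ω) t)ᶜ :=
    hg.infDist_range_le_infDist_compl_domain hzdom
  have h2 : infDist z (domain (sleDriving κ ω) t)ᶜ * ‖deriv (sleMap κ ω t) z‖ ≤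
      2 * (sleMap κ ω t z).im :=
    infDist_compl_domain_mul_norm_deriv_map_le hW hzdom
  have h3 : 2 * z.im / ε + 1 ≤ z.im * ‖deriv (sleMap κ ω t) z‖ / (sleMap κ ω t z).im := ht
  rw [le_div_iff₀ him] at h3
  have hMpos : 0 < 2 * z.im / ε + 1 := by positivity
  have hD : 0 < ‖deriv (sleMap κ ω t) z‖ := by
    refine lt_of_not_ge fun hD ↦ ?_
    have : z.im * ‖deriv (sleMap κ ω t) z‖ ≤ 0 := mul_nonpos_of_nonneg_of_nonpos hzim.le hD
    nlinarith [mul_pos hMpos him]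
  set r := infDist z (domain (sleDriving κ ω) t)ᶜ with hr_def
  set D := ‖deriv (sleMap κ ω t) z‖ with hD_def
  set M := 2 * z.im / ε + 1 with hM_def
  have h4 : r * D * M ≤ 2 * (z.im * D) := by
    calc r * D * M ≤ 2 * (sleMap κ ω t z).im * M := by gcongr
      _ = 2 * (M * (sleMap κ ω t z).im) := by ring
      _ ≤ 2 * (z.im * D) := by gcongr
  have h5 : r * M ≤ 2 * z.im := le_of_mul_le_mul_right (by nlinarith [h4]) hD
  have h6 : r < ε := by
    refine lt_of_not_ge fun h7 ↦ ?_
    have : ε * M ≤ 2 * z.im := (mul_le_mul_of_nonneg_right h7 hMpos.le).trans h5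
    have hεM : ε * M = 2 * z.im + ε := by rw [hM_def]; field_simp
    linarith
  linarith [infDist_nonneg (x := z) (s := S)]

/-- **`ℍ ⊆ closure γ[0, ∞)` almost surely, for one `κ ≥ 8` with `HasSLETrace κ`** (countable dense
set of points, each a.s. at distance `0` from `γ[0,∞) ∪ ℝ`; as in
`ae_subset_closure_range_sleTrace`). [cite: RohdeSchramm2005, proof of Cor. 7.4] -/
theorem ae_subset_closure_range_sleTrace_of_hasSLETrace {κ : ℝ≥0} (hγ : HasSLETrace κ)
    (hκ : 8 ≤ κ) :
    ∀ᵐ ω ∂Process.preWienerMeasure, upperHalfPlaneSet ⊆ closure (range (sleTrace κ ω)) := by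
  obtain ⟨D, hDsub, hDc, hDd⟩ :=
    (TopologicalSpace.IsSeparable.of_separableSpace upperHalfPlaneSet).exists_countable_dense_subset
  have hD : ∀ᵐ ω ∂Process.preWienerMeasure, ∀ z ∈ D,
      infDist z (range (sleTrace κ ω) ∪ {w : ℂ | w.im = 0}) = 0 :=
    (ae_ball_iff hDc).2 fun z hz ↦ ae_infDist_sleTrace_eq_zero_of_hasSLETrace hγ hκ (hDsub hz)
  filter_upwards [hD] with ω hω
  have hDcl : D ⊆ closure (range (sleTrace κ ω)) := fun z hz ↦
    mem_closure_of_infDist_union_eq_zero (hDsub hz) (range_nonempty _) (hω z hz)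
  exact hDd.trans (closure_minimal hDcl isClosed_closure)

/-- **Space-filling for one `κ ≥ 8` from trace existence and transience at that `κ`**
(Rohde–Schramm (2005), Cor. 7.4 and Update, p. 911: dense by Lemma 6.3 + (6.2), closed by
transience): if SLE_κ is a.s. generated by a curve and its trace is a.s. transient, then for
`κ ≥ 8` the trace is a.s. space-filling. Lemma 6.3 is no longer a hypothesis.
[cite: RohdeSchramm2005, Cor. 7.4 and Update (p. 911)] -/
theorem ae_isSpaceFilling_sleTrace_of_hasSLETrace_of_eight_le {κ : ℝ≥0} (hγ : HasSLETrace κ)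
    (htr : ∀ᵐ ω ∂Process.preWienerMeasure, Tendsto (fun t ↦ ‖sleTrace κ ω t‖) atTop atTop)
    (hκ : 8 ≤ κ) :
    ∀ᵐ ω ∂Process.preWienerMeasure, IsSpaceFilling (sleTrace κ ω) :=
  ae_isSpaceFilling_sleTrace_of_hasSLETrace hγ htr (ae_subset_closure_range_sleTrace_of_hasSLETrace hγ hκ)

/-- **Cor. 7.4 as printed (`κ > 8`) from Rohde–Schramm's own theorems only**: for `κ > 8`, the
space-filling phase follows from Thm 5.1 (`hasSLETrace_of_ne_eight`) and Thm 7.1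
(`tendsto_norm_sleTrace_atTop`); Lawler–Schramm–Werner (2004) is needed only at `κ = 8`.
[cite: RohdeSchramm2005, Cor. 7.4] -/
theorem ae_isSpaceFilling_sleTrace_of_eight_lt_of_RS05 (hne : hasSLETrace_of_ne_eight)
    (htr : tendsto_norm_sleTrace_atTop) {κ : ℝ≥0} (hκ : 8 < κ) :
    ∀ᵐ ω ∂Process.preWienerMeasure, IsSpaceFilling (sleTrace κ ω) :=
  ae_isSpaceFilling_sleTrace_of_hasSLETrace_of_eight_le (hne hκ.ne')
    (htr ((by norm_num : (0 : ℝ≥0) < 8).trans hκ)) hκ.le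

/-- **SLE₈ is space-filling from LSW04 Thm 4.7 and transience at `κ = 8`** (the Update to
Cor. 7.4, p. 911). [cite: RohdeSchramm2005, Cor. 7.4 and Update (p. 911)] -/
theorem ae_isSpaceFilling_sleTrace_eight_of (h8 : hasSLETrace_eight)
    (htr : ∀ᵐ ω ∂Process.preWienerMeasure, Tendsto (fun t ↦ ‖sleTrace 8 ω t‖) atTop atTop) :
    ∀ᵐ ω ∂Process.preWienerMeasure, IsSpaceFilling (sleTrace 8 ω) :=
  ae_isSpaceFilling_sleTrace_of_hasSLETrace_of_eight_le h8 htr le_rfl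

end PerKappa

end Literature.Probability.RandomPlanarGeometry
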